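import Literature.Probability.Percolation.QuadLowestCrossingProofs
import Literature.Probability.Percolation.QuadCrossingQuadTopology
import Literature.Probability.Percolation.QuadCrossingDuality
import HarnessLib

/-!
# Frames charting a quad: the chart, revealed edges from `R'`, and the lowest crossing in the plane

Topic `Probability/Percolation`; proofs file towards the named fact `SchrammSmirnov2011_lemma_6_1`
(`QuadCrossingContinuity.lean`; O. Schramm, S. Smirnov, *On the scaling limits of planar
percolation*, Ann. Probab. 39 (2011), arXiv:1101.5820, proof of Lemma 6.1, p. 22: "let `γ` be the
'lowest' `ω`-crossing of `Q'` … and let `x` be the endpoint of `γ` on `∂₂Q'` … The lowest crossing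
`γ` depends only on the configuration inside `M̄`").

The lowest crossing of a charted rectangle is in the tree (`QuadDualExploration.lean`: the explored
region `Λ` of a `Frame`; `QuadLowestCrossingDefs/Proofs.lean`: `Frame.Crossed`,
`Frame.IsFrontierCrossing`, `Frame.exists_frontierCrossing`, the endpoint `Frame.wallPt` with
`Frame.wallPt_mem_of_isFrontierCrossing`, `Frame.im_le_wallTop`).  This file connects it with the
quads of `QuadCrossingSpace.lean`, for the continuity lemma stated on arbitrary quads:

* `Frame.Charts Q` — the frame charts the quad `Q` (`G(R') = [Q]`, sides to sides), and
  `Quad.exists_frame_charts` — every quad is charted by a frame of any mesh (Schoenflies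
  straightening `Quad.exists_straighten`);
* `Frame.Charts.crossed` — an open crossing of `Q` (`Quad.IsCrossing K`, `K ⊆ openEdgeUnion`) makes
  `G(R')` crossed in the chart sense; `Frame.Charts.image_isFrontierCrossing` — the image of a
  frontier crossing is an open continuum of `[Q]` meeting `∂₀Q` and `∂₂Q` (a connected subset of the
  drawn lattice with two points lies in the open edges); `Frame.Charts.image_wallPt_mem_side_two` —
  the endpoint `x = G(wallPt)` lies on `∂₂Q`;
* `Frame.revealedIn Λ₀` — the revealed edges computed from chart points of `R'` only (the margin of
  `R''` carries no obstacle) and `Frame.determinedBy_explored_eq_revealedIn` — `{Λ = Λ₀}` is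
  determined by them (the proof of `Frame.determinedBy_explored_eq` verbatim; fewer revealed edges
  means a larger fresh region for the decoupling);
* small path tools (`Frame.mem_explored_of_path`, `Frame.segPath`).

Everything is proved; no named fact is introduced.

## References

* O. Schramm, S. Smirnov, Ann. Probab. 39 (2011) 1768–1814, arXiv:1101.5820, proof of Lemma 6.1,
  p. 22. [SchrammSmirnov2011]
* G. Grimmett, *Percolation*, 2nd ed. (1999), §11.3 (lowest crossings). [GrimmettPercolation1999]
-/

noncomputable section

open Set Metric Filter Function Complex
open _root_.MeasureTheory _root_.Topology
open Literature.Probability.LatticeModels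
open Literature.Topology.PlaneTopology

namespace Literature.Probability.Percolation

namespace SSContinuity

namespace Frame

variable (Φ : Frame) {D : Set ℂ}

/-! ### Frames charting a quad -/

/-- The frame `Φ` **charts the quad `Q`**: `G(R') = [Q]` and the four sides of `R'` (left, bottom,
right, top) are mapped onto `∂₀Q, ∂₁Q, ∂₂Q, ∂₃Q`. [cite: SchrammSmirnov2011, proof of Lemma 6.1] -/
structure Charts (Q : QuadCrossing.Quad D) : Prop where
  carrier : Q.carrier = Φ.G '' Φ.rect
  side0 : Q.side 0 = Φ.G '' {z | z ∈ Φ.rect ∧ z.re = Φ.a}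
  side1 : Q.side 1 = Φ.G '' {z | z ∈ Φ.rect ∧ z.im = Φ.c}
  side2 : Q.side 2 = Φ.G '' {z | z ∈ Φ.rect ∧ z.re = Φ.b}
  side3 : Q.side 3 = Φ.G '' {z | z ∈ Φ.rect ∧ z.im = Φ.d}

end Frame

end SSContinuity

namespace QuadCrossing

namespace Quad

variable {D : Set ℂ}

/-- **Every quad is charted by a frame** of any prescribed mesh `δ > 0` (margin `1`, chart
rectangle `[-1,1]²`, chart `G` the Schoenflies straightening of `Quad.exists_straighten`).
[cite: SchrammSmirnov2011, proof of Lemma 6.1] -/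
theorem exists_frame_charts (Q : Quad D) {δ : ℝ} (hδ : 0 < δ) :
    ∃ Φ : SSContinuity.Frame, Φ.Charts Q ∧ Φ.δ = δ ∧ Φ.a = -1 ∧ Φ.b = 1 ∧ Φ.c = -1 ∧ Φ.d = 1 := by
  obtain ⟨H, -, hcar, h0, h1, h2, h3⟩ := Q.exists_straighten
  refine ⟨⟨H, -1, 1, -1, 1, 1, δ, 1, by norm_num, by norm_num, by norm_num, hδ, by norm_num⟩,
    ⟨hcar, h0, h1, h2, h3⟩, rfl, rfl, rfl, rfl, rfl⟩

end Quad

end QuadCrossing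

namespace SSContinuity

namespace Frame

variable (Φ : Frame)

/-! ### Revealed edges seen from the chart rectangle only -/

/-- **Revealed edges of `Λ₀`, rectangle form**: the lattice edges whose open segment, pulled back
by the chart, meets `closure Λ₀ ∩ R'` (the margin `R'' ∖ R'` carries no obstacle, so only these
edges matter). [cite: SchrammSmirnov2011, proof of Lemma 6.1] -/
def revealedIn (Λ₀ : Set ℂ) : Set (Sym2 (Site 2)) :=
  {e | ∃ x y : Site 2, (zdGraph 2).Adj x y ∧ e = s(x, y) ∧
    ∃ u ∈ closure Λ₀, u ∈ Φ.rect ∧ Φ.G u ∈ openSegment ℝ (meshPoint Φ.δ x) (meshPoint Φ.δ y)}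

/-- `revealedIn Λ₀ ⊆ revealed Λ₀`. [folklore] -/
theorem revealedIn_subset_revealed (Λ₀ : Set ℂ) : Φ.revealedIn Λ₀ ⊆ Φ.revealed Λ₀ := by
  rintro e ⟨x, y, hxy, rfl, u, hu, -, hseg⟩
  exact ⟨x, y, hxy, rfl, u, hu, hseg⟩

/-- Two configurations agreeing on `revealedIn Λ₀` have the same obstacles on `closure Λ₀`
(obstacles lie in `R'`). [cite: SchrammSmirnov2011, proof of Lemma 6.1] -/
theorem mem_obstacle_iff_of_inter_revealedIn_eq {ω ω' : BondConfig (Site 2)} {Λ₀ : Set ℂ}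
    (h : ω ∩ Φ.revealedIn Λ₀ = ω' ∩ Φ.revealedIn Λ₀) {u : ℂ} (hu : u ∈ closure Λ₀) :
    u ∈ Φ.obstacle ω ↔ u ∈ Φ.obstacle ω' := by
  suffices key : ∀ ω ω' : BondConfig (Site 2), ω ∩ Φ.revealedIn Λ₀ = ω' ∩ Φ.revealedIn Λ₀ →
      u ∈ Φ.obstacle ω → u ∈ Φ.obstacle ω' from ⟨key ω ω' h, key ω' ω h.symm⟩
  intro ω ω' h hu'
  refine ⟨hu'.1, ?_⟩
  rcases hu'.2 with hO | hV
  · by_cases hV : Φ.G u ∈ range (meshPoint Φ.δ)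
    · exact Or.inr hV
    obtain ⟨x, y, hxy, hω, hseg⟩ := mem_openEdgeUnion_iff.1 hO
    have hrev : s(x, y) ∈ Φ.revealedIn Λ₀ :=
      ⟨x, y, hxy, rfl, u, hu, hu'.1, mem_openSegment_of_not_mem_range hseg hV⟩
    have hω' : s(x, y) ∈ ω' := by
      have : s(x, y) ∈ ω ∩ Φ.revealedIn Λ₀ := ⟨hω, hrev⟩
      rw [h] at this
      exact this.1
    exact Or.inl (mem_openEdgeUnion_iff.2 ⟨x, y, hxy, hω', hseg⟩)
  · exact Or.inr hV

/-- **`{Λ = Λ₀}` is determined by `revealedIn Λ₀`** (the argument of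
`Frame.explored_eq_of_inter_revealed_eq`, which only evaluates obstacles at points of
`closure Λ₀`). [cite: SchrammSmirnov2011, proof of Lemma 6.1] -/
theorem explored_eq_of_inter_revealedIn_eq {ω ω' : BondConfig (Site 2)} {Λ₀ : Set ℂ}
    (h : ω ∩ Φ.revealedIn Λ₀ = ω' ∩ Φ.revealedIn Λ₀) (hω : Φ.explored ω = Λ₀) :
    Φ.explored ω' = Λ₀ := by
  have hiff : ∀ u ∈ closure Λ₀, (u ∈ Φ.obstacle ω ↔ u ∈ Φ.obstacle ω') := fun u hu =>
    Φ.mem_obstacle_iff_of_inter_revealedIn_eq h hu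
  refine subset_antisymm ?_ ?_
  · intro u hu
    by_contra huΛ
    obtain ⟨huE, p, hp, hJ⟩ := hu
    obtain ⟨γ, hγ⟩ := hJ
    have hp0 : p ∈ Φ.explored ω := Φ.mem_explored_of_mem_bottom hp
    obtain ⟨t₀, ht₀I, -, hcl, hnot, -⟩ := Φ.exists_first_exit (f := fun t => γ.extend t)
      (γ.continuous_extend.continuousOn) (fun t _ => (hγ _).1)
      (by simpa using hp0) (by simpa [hω] using huΛ)
    have hobs : γ.extend t₀ ∈ Φ.obstacle ω := Φ.mem_obstacle_of_mem_closure_diff hcl hnot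
    have hobs' : γ.extend t₀ ∈ Φ.obstacle ω' := (hiff _ (by rwa [hω] at hcl)).1 hobs
    exact (hγ _).2 hobs'
  · intro u hu
    rw [← hω] at hu
    obtain ⟨huE, p, hp, hJ⟩ := hu
    obtain ⟨γ, hγ⟩ := hJ
    have hp0 : p ∈ Φ.explored ω := Φ.mem_explored_of_mem_bottom hp
    refine ⟨huE, p, hp, ⟨γ, fun t => ⟨(hγ t).1, fun hobs' => ?_⟩⟩⟩
    have hγt : γ t ∈ Φ.explored ω := by
      have hsub : ∀ s, γ.truncate 0 t s ∈ Φ.extRect \ Φ.obstacle ω := fun s => by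
        obtain ⟨s', hs'⟩ := γ.truncate_range (t₀ := 0) (t₁ := t) ⟨s, rfl⟩
        rw [← hs']
        exact hγ s'
      have h0 : γ.extend (min 0 (t : ℝ)) = p := by rw [min_eq_left t.2.1]; simp
      have h1 : γ.extend t = γ t := γ.extend_extends' t
      exact Φ.mem_explored_of_joinedIn hp0 ⟨(γ.truncate 0 t).cast h0.symm h1.symm, hsub⟩
    have hcl : γ t ∈ closure Λ₀ := hω ▸ subset_closure hγt
    exact Φ.not_mem_obstacle_of_mem_explored hγt ((hiff _ hcl).2 hobs')

/-- **`{Λ = Λ₀}` is determined by `revealedIn Λ₀`.** [cite: SchrammSmirnov2011, proof of Lemma 6.1] -/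
theorem determinedBy_explored_eq_revealedIn (Λ₀ : Set ℂ) :
    DeterminedBy {ω | Φ.explored ω = Λ₀} (Φ.revealedIn Λ₀) := by
  rw [determinedBy_iff]
  intro ω ω' h
  exact ⟨fun hω => Φ.explored_eq_of_inter_revealedIn_eq h hω,
    fun hω' => Φ.explored_eq_of_inter_revealedIn_eq h.symm hω'⟩

/-! ### Explorer paths stay explored; a segment path -/

/-- Every point of an explorer path from the bottom side is explored. [folklore] -/
theorem mem_explored_of_path {ω : BondConfig (Site 2)} {p v : ℂ} (hp : p ∈ Φ.bottom)
    (γ : Path p v) (hγ : ∀ s, γ s ∈ Φ.extRect \ Φ.obstacle ω) (t : unitInterval) :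
    γ t ∈ Φ.explored ω := by
  have hp0 : p ∈ Φ.explored ω := Φ.mem_explored_of_mem_bottom hp
  have hsub : ∀ s, γ.truncate 0 t s ∈ Φ.extRect \ Φ.obstacle ω := fun s => by
    obtain ⟨s', hs'⟩ := γ.truncate_range (t₀ := 0) (t₁ := t) ⟨s, rfl⟩
    rw [← hs']
    exact hγ s'
  have h0 : γ.extend (min 0 (t : ℝ)) = p := by rw [min_eq_left t.2.1]; simp
  have h1 : γ.extend t = γ t := γ.extend_extends' t
  exact Φ.mem_explored_of_joinedIn hp0 ⟨(γ.truncate 0 t).cast h0.symm h1.symm, hsub⟩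

/-- The straight path from `v` to `u`. [folklore] -/
def segPath (v u : ℂ) : Path v u :=
  ⟨⟨fun s => AffineMap.lineMap v u (s : ℝ), AffineMap.lineMap_continuous.comp continuous_subtype_val⟩,
    by simp, by simp⟩

/-- Its range is the segment. [folklore] -/
theorem range_segPath (v u : ℂ) : range (segPath v u) = segment ℝ v u := by
  rw [segment_eq_image_lineMap]
  ext z
  constructor
  · rintro ⟨s, rfl⟩
    exact ⟨s, s.2, rfl⟩
  · rintro ⟨t, ht, rfl⟩
    exact ⟨⟨t, ht⟩, rfl⟩

/-! ### From quad crossings to chart crossings; the lowest crossing in the plane -/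

variable {D : Set ℂ} {Q : QuadCrossing.Quad D} {ω : BondConfig (Site 2)}

variable {Φ} in
/-- **An open crossing of the charted quad makes `G(R')` crossed** (pull the crossing back by
the chart). [cite: SchrammSmirnov2011, §1.3] -/
theorem Charts.crossed (hΦ : Φ.Charts Q) {K : Set ℂ} (hK : Q.IsCrossing K)
    (hKO : K ⊆ openEdgeUnion Φ.δ ω) : Φ.Crossed Φ.b ω := by
  obtain ⟨hKc, hKconn, hKsub, ⟨k₀, hk₀K, hk₀⟩, ⟨k₂, hk₂K, hk₂⟩⟩ := hK
  have hpre : ∀ {w : ℂ}, w ∈ Q.carrier → Φ.G.symm w ∈ Φ.rect := by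
    intro w hw
    rw [hΦ.carrier] at hw
    obtain ⟨u, hu, rfl⟩ := hw
    rwa [Φ.G.symm_apply_apply]
  refine ⟨Φ.G.symm '' K, fun _ ⟨w, hw, hwu⟩ => hwu ▸ hpre (hKsub hw), hKc.image Φ.G.symm.continuous,
    hKconn.image _ Φ.G.symm.continuous.continuousOn, ?_, ?_, ?_⟩
  · rintro _ ⟨w, hw, rfl⟩
    rw [Φ.G.apply_symm_apply]; exact hKO hw
  · rw [hΦ.side0] at hk₀
    obtain ⟨u, ⟨-, hure⟩, rfl⟩ := hk₀
    exact ⟨u, ⟨Φ.G u, hk₀K, Φ.G.symm_apply_apply u⟩, hure⟩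
  · rw [hΦ.side2] at hk₂
    obtain ⟨u, ⟨-, hure⟩, rfl⟩ := hk₂
    exact ⟨u, ⟨Φ.G u, hk₂K, Φ.G.symm_apply_apply u⟩, hure⟩

variable {Φ} in
/-- **The image of a frontier crossing is an open continuum of `[Q]` meeting `∂₀Q` and `∂₂Q`**
(a connected subset of the drawn lattice with two points lies in the open edges,
`closure_subset_openEdgeUnion_of_isPreconnected`). [cite: SchrammSmirnov2011, proof of Lemma 6.1] -/
theorem Charts.image_isFrontierCrossing (hΦ : Φ.Charts Q) {Γ : Set ℂ}
    (hΓ : Φ.IsFrontierCrossing ω Γ) :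
    Φ.G '' Γ ⊆ openEdgeUnion Φ.δ ω ∧ Φ.G '' Γ ⊆ Q.carrier ∧ IsCompact (Φ.G '' Γ) ∧
      IsConnected (Φ.G '' Γ) ∧ (Φ.G '' Γ ∩ Q.side 0).Nonempty ∧ (Φ.G '' Γ ∩ Q.side 2).Nonempty := by
  have hΓobs : Γ ⊆ Φ.obstacle ω := hΓ.subset_obstacle
  have hΓrect : Γ ⊆ Φ.rect := hΓ.subset_rect
  obtain ⟨-, hΓc, hΓconn, ⟨za, hza, hzare⟩, ⟨zb, hzb, hzbre⟩⟩ := hΓ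
  have hdrawn : Φ.G '' Γ ⊆ openEdgeUnion Φ.δ ω ∪ range (meshPoint Φ.δ) := by
    rintro _ ⟨u, hu, rfl⟩
    exact (hΓobs hu).2
  have hne : Φ.G za ≠ Φ.G zb := fun h => by
    have := Φ.G.injective h
    rw [← this] at hzbre
    linarith [Φ.hab, hzare, hzbre]
  have hO : Φ.G '' Γ ⊆ openEdgeUnion Φ.δ ω :=
    subset_closure.trans (QuadCrossing.closure_subset_openEdgeUnion_of_isPreconnected Φ.hδ
      ((hΓconn.image _ Φ.G.continuous.continuousOn).isPreconnected) hdrawn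
      (mem_image_of_mem _ hza) (mem_image_of_mem _ hzb) hne)
  refine ⟨hO, ?_, hΓc.image Φ.G.continuous, hΓconn.image _ Φ.G.continuous.continuousOn, ?_, ?_⟩
  · rw [hΦ.carrier]; exact image_mono hΓrect
  · exact ⟨Φ.G za, mem_image_of_mem _ hza, hΦ.side0 ▸ ⟨za, ⟨hΓrect hza, hzare⟩, rfl⟩⟩
  · exact ⟨Φ.G zb, mem_image_of_mem _ hzb, hΦ.side2 ▸ ⟨zb, ⟨hΓrect hzb, hzbre⟩, rfl⟩⟩

/-- `wallPt ∈ R'` when `G(R')` is crossed. [cite: SchrammSmirnov2011, proof of Lemma 6.1] -/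
theorem wallPt_mem_rect (hcr : Φ.Crossed Φ.b ω) : Φ.wallPt ω ∈ Φ.rect :=
  Φ.obstacle_subset_rect ω (Φ.wallPt_mem_obstacle hcr)

variable {Φ} in
/-- **The endpoint `x = G(wallPt)` of the lowest crossing lies on `∂₂Q`.**
[cite: SchrammSmirnov2011, proof of Lemma 6.1] -/
theorem Charts.image_wallPt_mem_side_two (hΦ : Φ.Charts Q) (hcr : Φ.Crossed Φ.b ω) :
    Φ.G (Φ.wallPt ω) ∈ Q.side 2 := by
  rw [hΦ.side2]
  exact ⟨_, ⟨Φ.wallPt_mem_rect hcr, rfl⟩, rfl⟩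

/-- The endpoint lies on the image of every frontier crossing. [cite: SchrammSmirnov2011, proof of Lemma 6.1] -/
theorem image_wallPt_mem (hcr : Φ.Crossed Φ.b ω) {Γ : Set ℂ} (hΓ : Φ.IsFrontierCrossing ω Γ) :
    Φ.G (Φ.wallPt ω) ∈ Φ.G '' Γ :=
  mem_image_of_mem _ (Φ.wallPt_mem_of_isFrontierCrossing hcr hΓ)

end Frame

end SSContinuity

end Literature.Probability.Percolation
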